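import Literature.NumberTheory.Automorphic.LevelActionTwistedComparison
import Literature.NumberTheory.Automorphic.ParallelWeightAdelicCoefficients
import HarnessLib

/-!
# `H^q(X_U, Ṽ_wt(ℚ̄_p))` is the cohomology of the coefficients-at-`p` model, Hecke-equivariantly

Topic `NumberTheory/Automorphic`; namespace `Literature.NumberTheory.Automorphic.ParallelWeight`.
Two `def`s (the level action and the comparison isomorphism) and theorems; no named fact.

Assembly of `LevelActionTwistedComparison` (generic: `H^i(U, σ|_Δ) ≅ H^i(X_U, Ṽ_{σ ∘ ι})` with the
Hecke operators equal on the nose) and `ParallelWeightAdelicCoefficients` (`padicCoeffRep p F n wt`,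
the action of `GL_n(𝔸_F^∞)` on `⨂_{τ : F → ℚ̄_p} V_wt(ℚ̄_p)` through the `p`-adic places, with
`padicCoeffRep ∘ ι = coeffRep`): for every Hecke monoid `Δ ≤ GL_n(𝔸_F^∞)` containing the level `U`,

* `padicLevelCoeff Δ` — the level action `σ|_Δ` on the rational parallel-weight coefficients;
* `levelActionIso Δ U hU q :
    LevelAction.cohomology ι Δ (σ|_Δ) U q ≅ ParallelWeight.cohomology ℚ̄_p F n wt U q`
  (`ι = globalEmbedding`) — **the receptacle `H^q(X_U, Ṽ_wt(ℚ̄_p))` of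
  `hidaControl_dominantOrdinaryPoint` is the cohomology of the coefficients-at-`p` model** —
  with `levelActionIso_hom_heckeCohomology`: `Φ ([UαU] x) = heckeOp … α (Φ x)` for every `α ∈ Δ`;
* `exists_heckeOp_eigenclass`, `exists_heckeT_eigenclass` — a non-zero simultaneous eigenclass of
  the coefficients-at-`p` model yields a non-zero class `ξ ∈ H^q(X_U, Ṽ_wt(ℚ̄_p))` with
  `T_{w,j} ξ = a_{w,j} ξ` (`heckeT`, the operators of the fact), for the same (e.g. cofinitely many)
  places `w` and all `j` — the shape of the conclusion of `hidaControl_dominantOrdinaryPoint`.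

This is the last arrow of Hida's comparison [Hida1994AIF, §1] / [KhareThorne2017, §6.4–6.5]
between `H^•_ord(X_{U(c,c)}, M_𝛌 ⊗ E)` (coefficients at `p`) and classical weight-`𝛌` cohomology.

## References

* H. Hida, *p-adic ordinary Hecke algebras for GL(2)*, Ann. Inst. Fourier 44 (1994), §1 (held).
  [Hida1994AIF]
* C. Khare, J. A. Thorne, Amer. J. Math. 139 (2017), §6.4 Prop. 6.13, Cor. 6.15; §6.5 Lemma 6.17
  (arXiv:1409.7007, held). [KhareThorne2017]
-/

noncomputable section

open CategoryTheory
open scoped NumberField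
open IsDedekindDomain

namespace Literature.NumberTheory.Automorphic.ParallelWeight

open BigHeckeGLn

variable (F : Type) [Field F] [NumberField F] (n : ℕ) (wt : Fin n → ℤ) (p : ℕ) [Fact p.Prime]
  (Δ : Submonoid (FiniteAdelicGL n F))

/-- **The level action `σ|_Δ` on `⨂_τ V_wt(ℚ̄_p)`** of a Hecke monoid `Δ ≤ GL_n(𝔸_F^∞)`: the
restriction of `padicCoeffRep` (coefficients at `p`: the level acts on the coefficients through its
components above `p`). [cite: Hida1994AIF, §1] [cite: KhareThorne2017, §6.4] -/
def padicLevelCoeff : Δ →* Module.End (PadicAlgCl p) (CoeffModule (PadicAlgCl p) F n wt) :=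
  (padicCoeffRep F n wt p).comp Δ.subtype

/-- Unfolding lemma: `σ|_Δ (δ) = σ(δ)`. [folklore] -/
@[simp]
theorem padicLevelCoeff_apply (δ : Δ) : padicLevelCoeff F n wt p Δ δ = padicCoeffRep F n wt p δ :=
  rfl

variable (U : Subgroup (FiniteAdelicGL n F)) (hU : U.toSubmonoid ≤ Δ) (q : ℕ)

/-- **`H^q(U, σ|_Δ) ≅ H^q(X_U, Ṽ_wt(ℚ̄_p))`**: the cohomology of the coefficients-at-`p` model of level
`U ⊆ Δ` with coefficients `⨂_τ V_wt(ℚ̄_p)` is the receptacle `ParallelWeight.cohomology` of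
`hidaControl_dominantOrdinaryPoint` (`LevelAction.twistedCohomologyIso` followed by
`cohomologyIsoPadic`). [cite: Hida1994AIF, §1] [cite: KhareThorne2017, §6.4 Prop. 6.13, Cor. 6.15] -/
def levelActionIso :
    LevelAction.cohomology (globalEmbedding n F) Δ (padicLevelCoeff F n wt p Δ) U q ≅
      cohomology (PadicAlgCl p) F n wt U q :=
  LevelAction.twistedCohomologyIso (globalEmbedding n F) Δ (padicLevelCoeff F n wt p Δ) U
      (padicCoeffRep F n wt p) (fun _ => rfl) hU q ≪≫
    cohomologyIsoPadic F n wt p U q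

/-- **Hecke-equivariance: `Φ ([UαU] x) = heckeOp … α (Φ x)`** for every `α ∈ Δ` (the optimally
integral operators of the coefficients-at-`p` model are the plain double-coset operators `heckeOp` of
the fact's receptacle). [cite: Hida1994AIF, §1] -/
theorem levelActionIso_hom_heckeCohomology {α : FiniteAdelicGL n F} (hα : α ∈ Δ)
    (x : LevelAction.cohomology (globalEmbedding n F) Δ (padicLevelCoeff F n wt p Δ) U q) :
    (levelActionIso F n wt p Δ U hU q).hom.hom
        (LevelAction.heckeCohomology (globalEmbedding n F) Δ (padicLevelCoeff F n wt p Δ) U hU hα q x) =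
      heckeOp (PadicAlgCl p) F n wt U q α ((levelActionIso F n wt p Δ U hU q).hom.hom x) := by
  change (cohomologyIsoPadic F n wt p U q).hom.hom
      ((LevelAction.twistedCohomologyIso (globalEmbedding n F) Δ (padicLevelCoeff F n wt p Δ) U
        (padicCoeffRep F n wt p) (fun _ => rfl) hU q).hom.hom _) =
    heckeOp (PadicAlgCl p) F n wt U q α ((cohomologyIsoPadic F n wt p U q).hom.hom
      ((LevelAction.twistedCohomologyIso (globalEmbedding n F) Δ (padicLevelCoeff F n wt p Δ) U
        (padicCoeffRep F n wt p) (fun _ => rfl) hU q).hom.hom x))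
  rw [LevelAction.twistedCohomologyIso_hom_heckeCohomology_apply, cohomologyIsoPadic_hom_heckeEnd]

/-- Eigenvectors go to eigenvectors with the same eigenvalue. [folklore] -/
theorem levelActionIso_eigenvector {α : FiniteAdelicGL n F} (hα : α ∈ Δ)
    {x : LevelAction.cohomology (globalEmbedding n F) Δ (padicLevelCoeff F n wt p Δ) U q}
    {a : PadicAlgCl p}
    (hx : LevelAction.heckeCohomology (globalEmbedding n F) Δ (padicLevelCoeff F n wt p Δ) U hU hα q x =
      a • x) :
    heckeOp (PadicAlgCl p) F n wt U q α ((levelActionIso F n wt p Δ U hU q).hom.hom x) =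
      a • (levelActionIso F n wt p Δ U hU q).hom.hom x := by
  rw [← levelActionIso_hom_heckeCohomology F n wt p Δ U hU q hα, hx, map_smul]

/-- `Φ x ≠ 0 ↔ x ≠ 0`. [folklore] -/
theorem levelActionIso_hom_apply_ne_zero_iff
    (x : LevelAction.cohomology (globalEmbedding n F) Δ (padicLevelCoeff F n wt p Δ) U q) :
    (levelActionIso F n wt p Δ U hU q).hom.hom x ≠ 0 ↔ x ≠ 0 :=
  (levelActionIso F n wt p Δ U hU q).toLinearEquiv.map_ne_zero_iff

/-- **A non-zero simultaneous eigenclass of the coefficients-at-`p` model gives a non-zero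
simultaneous eigenclass in `H^q(X_U, Ṽ_wt(ℚ̄_p))` with the same eigenvalues** (any family of Hecke
elements in `Δ`). [cite: KhareThorne2017, §6.5 Lemma 6.17] -/
theorem exists_heckeOp_eigenclass {J : Type*} (g : J → FiniteAdelicGL n F) (hg : ∀ j, g j ∈ Δ)
    (a : J → PadicAlgCl p)
    {x : LevelAction.cohomology (globalEmbedding n F) Δ (padicLevelCoeff F n wt p Δ) U q} (hx0 : x ≠ 0)
    (hx : ∀ j, LevelAction.heckeCohomology (globalEmbedding n F) Δ (padicLevelCoeff F n wt p Δ) U hU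
      (hg j) q x = a j • x) :
    ∃ ξ : cohomology (PadicAlgCl p) F n wt U q, ξ ≠ 0 ∧ ∀ j, heckeOp (PadicAlgCl p) F n wt U q (g j) ξ = a j • ξ :=
  ⟨(levelActionIso F n wt p Δ U hU q).hom.hom x,
    (levelActionIso_hom_apply_ne_zero_iff F n wt p Δ U hU q x).2 hx0,
    fun j => levelActionIso_eigenvector F n wt p Δ U hU q (hg j) (hx j)⟩

/-- **The shape of the conclusion of `hidaControl_dominantOrdinaryPoint`.**  If all the `t_{w,j}`,
`w ∈ W`, lie in `Δ` and a non-zero class `x` of the coefficients-at-`p` model satisfies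
`[U t_{w,j} U] x = a_{w,j} x` for all `w ∈ W` and all `j`, then there is a non-zero
`ξ ∈ H^q(X_U, Ṽ_wt(ℚ̄_p))` with `T_{w,j} ξ = a_{w,j} ξ` (`ParallelWeight.heckeT`) for all `w ∈ W` and
all `j`; with `W` cofinite this is `∀ᶠ w in cofinite, ∀ j, heckeT … w j ξ = a w j • ξ`.
[cite: KhareThorne2017, §6.5 Lemma 6.17] [cite: Hida1994AIF, Thm. 3.2] -/
theorem exists_heckeT_eigenclass {W : Set (HeightOneSpectrum (𝓞 F))}
    (hW : ∀ w ∈ W, ∀ j : ℕ, heckeElement n F w j ∈ Δ) (a : HeightOneSpectrum (𝓞 F) → ℕ → PadicAlgCl p)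
    {x : LevelAction.cohomology (globalEmbedding n F) Δ (padicLevelCoeff F n wt p Δ) U q} (hx0 : x ≠ 0)
    (hx : ∀ (w : HeightOneSpectrum (𝓞 F)) (hw : w ∈ W) (j : ℕ),
      LevelAction.heckeCohomology (globalEmbedding n F) Δ (padicLevelCoeff F n wt p Δ) U hU (hW w hw j) q x =
        a w j • x) :
    ∃ ξ : cohomology (PadicAlgCl p) F n wt U q, ξ ≠ 0 ∧
      ∀ w ∈ W, ∀ j : ℕ, heckeT (PadicAlgCl p) F n wt U q w j ξ = a w j • ξ :=
  ⟨(levelActionIso F n wt p Δ U hU q).hom.hom x,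
    (levelActionIso_hom_apply_ne_zero_iff F n wt p Δ U hU q x).2 hx0,
    fun w hw j => levelActionIso_eigenvector F n wt p Δ U hU q (hW w hw j) (hx w hw j)⟩

/-- Cofinite form: eigen-relations at cofinitely many `w` transfer to `∀ᶠ w in cofinite`. [folklore] -/
theorem exists_heckeT_eigenclass_cofinite {W : Set (HeightOneSpectrum (𝓞 F))} (hWc : Wᶜ.Finite)
    (hW : ∀ w ∈ W, ∀ j : ℕ, heckeElement n F w j ∈ Δ) (a : HeightOneSpectrum (𝓞 F) → ℕ → PadicAlgCl p)
    {x : LevelAction.cohomology (globalEmbedding n F) Δ (padicLevelCoeff F n wt p Δ) U q} (hx0 : x ≠ 0)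
    (hx : ∀ (w : HeightOneSpectrum (𝓞 F)) (hw : w ∈ W) (j : ℕ),
      LevelAction.heckeCohomology (globalEmbedding n F) Δ (padicLevelCoeff F n wt p Δ) U hU (hW w hw j) q x =
        a w j • x) :
    ∃ ξ : cohomology (PadicAlgCl p) F n wt U q, ξ ≠ 0 ∧
      ∀ᶠ w in Filter.cofinite, ∀ j : ℕ, heckeT (PadicAlgCl p) F n wt U q w j ξ = a w j • ξ := by
  obtain ⟨ξ, hξ0, hξ⟩ := exists_heckeT_eigenclass F n wt p Δ U hU q hW a hx0 hx
  exact ⟨ξ, hξ0, Filter.mem_cofinite.2 (hWc.subset fun w hw hwW => hw fun j => hξ w hwW j)⟩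

end Literature.NumberTheory.Automorphic.ParallelWeight
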